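import Summits.NavierStokesRegularity.FluidComputer.GateBudgetCleanRunSharp
import Summits.NavierStokesRegularity.FluidComputer.GateBudgetCleanHorizonHeadline
import Summits.NavierStokesRegularity.FluidComputer.GateBudgetOutputDudTime
import HarnessLib

/-!
# GateBudget part 128 — the θ-priced rung, V: the clean dud horizon of the headline member,
# `0.076K⁹ ≤ cleanHorizon ≤ 0.1132K⁹ + 1`, and the dud horizon in time (§332–§334)

Cell `pub-fluidc`, blueprint seat bp1 (gen 42; SPEC-INPUT-bp1 §CR(3)(b), §CS);
namespace `Summit.NavierStokesRegularity.FluidComputer.GateBudget`, headline member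
`RotorKnob.rotorCircuit K K¹⁰ (K¹⁰ρ²) ρ` from `delayInit`, `K ≥ 16`. HONEST FRAMING: a low
prior, high value-of-information experiment on Tao's machine paradigm; NOT a claim that NS
blows up. Nothing here is about the Navier–Stokes equations: these are inequalities about the
five-mode toy circuit (5.5)/(5.6).

* §332 `clean_window_ceil_sharp` — the √-window of part 127 §331 holds at `N₀ = ⌈0.076K⁹⌉`
  (`0.076·1.662 = 0.126312`, `34·9 log K/K⁴ ≤ 0.013` by `log K ≤ (log 16/16)K`, `K³ ≥ 4096`).
* §332 `knob_clean_horizon_floor_sharp` — THE FLOOR, θ-PRICED: on the unit lattice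
  `0.076K⁹ ≤ cleanHorizon K ε ρ X (29/20)` (part 118 §314's floor `0.065K⁹`, same object, same
  proof through part 127 §331).
* §333 `knob_clean_horizon_headline_sharp` — HYPOTHESIS-MINIMAL: `K ≥ 16`, `0 < ρ`,
  `ρ⁴ ≤ 1/(6K⁴⁰)`, (5.5) from (5.6) ⟹ `0.076K⁹ ≤ cleanHorizon K (K¹⁰ρ²) ρ X (29/20) ≤
  0.1132K⁹ + 1` — the two constants now a factor `1.49` apart (part 119: `0.065`, factor `1.74`).
* §334 `knob_output_dud_time_sharp` — THE DUD HORIZON IN TIME, θ-PRICED: under the same three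
  hypotheses `0 ≤ ã(t)` and `ã(t)² ≤ 1/50` for all `t ∈ [0, 0.076K⁹ + 1]` (part 123 §325:
  `[0, 0.065K⁹ + 1]`), by part 123 §324 `output_dud_of_run` at the last rung of part 127's
  run.

WHAT THIS SAYS (and does not). Feeding the ladder's own clock floor `θ ≥ 1.365` into the swing
price moves the certified floor of the clean dud horizon from `0.065K⁹` to `0.076K⁹` clean
misfires (`+17%`), against the unchanged ceiling `0.1132K⁹ + 1`; the remaining factor `1.49` is
the √-window's (the ledger stops at `P ≤ 1/50`; the true run may be longer) and the ceiling's
crude per-cycle drop. HONEST LIMITS: (i) `k = 1`; (ii) one-sided in time (no claim past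
`0.076K⁹ + 1`); (iii) nothing about NS.
[cite: Tao2016AveragedNS, §5.5 Theorem 5.3, (5.5), (b-eq), (c-eq), (d-eq), (energy-con)]
-/

noncomputable section

namespace Summit.NavierStokesRegularity.FluidComputer.GateBudget

open Real Set Filter Topology
open Literature.Analysis.FluidPDE.Tao2016AveragedNS

variable {K M ε ρ : ℝ} {X : ℝ → Fin 5 → ℝ} {C : ℝ → ℝ}

/-! ## §332 The floor of the clean dud horizon, θ-priced -/

/-- §332 THE WINDOW AT `N₀ = ⌈0.076K⁹⌉` (`K ≥ 16`): `1 ≤ N₀`, `N₀ ≤ K⁹`, and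
`(N₀ - 1)·1.662/K⁹ + 34 log N₀/K⁴ ≤ 0.1409` (`0.126312 + 0.013 ≤ 0.1409`; `log N₀ ≤ 9 log K`,
`log K ≤ (log 16/16)·K` by `Real.log_div_self_antitoneOn`, `K³ ≥ 4096`).
[numerics; `Real.log_div_self_antitoneOn`, `Real.log_two_lt_d9`, `Real.exp_one_lt_d9`] -/
theorem clean_window_ceil_sharp (hK : 16 ≤ K) :
    1 ≤ ⌈76 / 1000 * K ^ 9⌉₊ ∧ (⌈76 / 1000 * K ^ 9⌉₊ : ℝ) ≤ K ^ 9 ∧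
      ((⌈76 / 1000 * K ^ 9⌉₊ : ℝ) - 1) * (1662 / 1000 / K ^ 9)
        + 34 / K ^ 4 * log (⌈76 / 1000 * K ^ 9⌉₊ : ℝ) ≤ 1409 / 10000 := by
  set N₀ : ℕ := ⌈76 / 1000 * K ^ 9⌉₊ with hN₀_def
  have hK0 : (0 : ℝ) < K := by linarith
  have hK9 : (0 : ℝ) < K ^ 9 := by positivity
  have hc0 : (0 : ℝ) ≤ 76 / 1000 * K ^ 9 := by positivity
  have hN₀le : 76 / 1000 * K ^ 9 ≤ (N₀ : ℝ) := Nat.le_ceil _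
  have hN₀lt : (N₀ : ℝ) < 76 / 1000 * K ^ 9 + 1 := Nat.ceil_lt_add_one hc0
  have hK9big : (68719476736 : ℝ) ≤ K ^ 9 := by
    have := pow_le_pow_left₀ (by norm_num : (0 : ℝ) ≤ 16) hK 9; norm_num at this; exact this
  have hN₀posR : (0 : ℝ) < N₀ := by linarith only [hN₀le, hK9big]
  have hN₀pos : 1 ≤ N₀ := Nat.succ_le_of_lt (by exact_mod_cast hN₀posR)
  -- `log K ≤ (log 16/16)·K` (`Real.log_div_self_antitoneOn`, as part 118 §314) and `K³ ≥ 4096`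
  have he16 : exp 1 ≤ 16 := by have := Real.exp_one_lt_d9; linarith
  have hmono := Real.log_div_self_antitoneOn (show (16 : ℝ) ∈ Set.Ici (exp 1) from he16)
    (show K ∈ Set.Ici (exp 1) from le_trans he16 hK) hK
  simp only at hmono
  have hlog16 : log 16 ≤ 2773 / 1000 := by
    have e : log (16 : ℝ) = 4 * log 2 := by
      rw [show (16 : ℝ) = 2 ^ 4 by norm_num, Real.log_pow]; norm_num
    rw [e]; linarith only [Real.log_two_lt_d9]
  have hl : log K ≤ 2773 / 16000 * K := by
    rw [div_le_iff₀ hK0] at hmono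
    have := mul_le_mul_of_nonneg_right (div_le_div_of_nonneg_right hlog16 (by norm_num :
      (0 : ℝ) ≤ 16)) hK0.le
    linarith only [hmono, this]
  have hK3 : (4096 : ℝ) ≤ K ^ 3 := by
    have := pow_le_pow_left₀ (by norm_num : (0 : ℝ) ≤ 16) hK 3; norm_num at this; exact this
  have hlogt : 34 / K ^ 4 * (9 * log K) ≤ 13 / 1000 := by
    rw [div_mul_eq_mul_div, div_le_iff₀ (by positivity)]
    have h2 : 306 * (2773 / 16000) ≤ 13 / 1000 * K ^ 3 := by linarith only [hK3]
    calc 34 * (9 * log K) ≤ 306 * (2773 / 16000) * K := by linarith only [hl]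
      _ ≤ 13 / 1000 * K ^ 3 * K := mul_le_mul_of_nonneg_right h2 hK0.le
      _ = 13 / 1000 * K ^ 4 := by ring
  have hN₀K : (N₀ : ℝ) ≤ K ^ 9 := by linarith only [hN₀lt, hK9big]
  have hlogN : log (N₀ : ℝ) ≤ 9 * log K := by
    have h := Real.log_le_log hN₀posR hN₀K
    have h9 : log (K ^ 9) = 9 * log K := by rw [Real.log_pow]; norm_num
    linarith only [h, h9]
  refine ⟨hN₀pos, hN₀K, ?_⟩
  have hcM0 : (0 : ℝ) ≤ 34 / K ^ 4 := by positivity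
  have h1 : ((N₀ : ℝ) - 1) * (1662 / 1000 / K ^ 9) ≤ 126312 / 1000000 := by
    have h := mul_le_mul_of_nonneg_right
      (le_of_lt (by linarith only [hN₀lt] : (N₀ : ℝ) - 1 < 76 / 1000 * K ^ 9))
      (by positivity : (0 : ℝ) ≤ 1662 / 1000 / K ^ 9)
    have e : 76 / 1000 * K ^ 9 * (1662 / 1000 / K ^ 9) = 126312 / 1000000 := by
      field_simp; ring
    linarith only [h, e]
  have h2 := mul_le_mul_of_nonneg_left hlogN hcM0
  linarith only [h1, h2, hlogt]

/-- §332 **THE FLOOR OF THE CLEAN DUD HORIZON, θ-PRICED** (headline member `rotorCircuit K K¹⁰ ε ρ`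
from `delayInit` with a trigger primitive `C`, `K ≥ 16`, `0 < ε`, `ε² ≤ 1/(6K²⁰)`, `0 < ρ`,
UNIT LATTICE `ε = K¹⁰ρ²`): `0.076·K⁹ ≤ cleanHorizon K ε ρ X (29/20)` — the machine misfires
cleanly at least `0.076K⁹` times in a row (its own θ-priced ladder, part 127 §331 at
`N₀ = ⌈0.076K⁹⌉`). Part 118 §314's floor argument, verbatim but for the run and the window.
[derived: part 127 §331, this file `clean_window_ceil_sharp`, part 118 §313, part 116 §308,
part 106 §288a; `Nat.sSup_mem`, `le_csSup`] -/
theorem knob_clean_horizon_floor_sharp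
    (hX : ∀ t, HasDerivAt X (RotorKnob.rotorCircuit K (K ^ 10) ε ρ (X t)) t)
    (h0 : X 0 = delayInit) (hC : ∀ t, HasDerivAt C (X t 2) t) (hK : 16 ≤ K) (hε : 0 < ε)
    (hεK : ε ^ 2 ≤ 1 / (6 * K ^ 20)) (hρ : 0 < ρ) (hlat : ε = K ^ 10 * ρ ^ 2) :
    76 / 1000 * K ^ 9 ≤ (cleanHorizon K ε ρ X (29 / 20) : ℝ) := by
  have hK0 : (0 : ℝ) < K := by linarith
  have hK9 : (0 : ℝ) < K ^ 9 := by positivity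
  -- the lengths of clean runs with clock ceiling `29/20` are bounded (part 116 §308)
  have hbdd : BddAbove {N : ℕ | ∃ r θ : ℕ → ℝ, IsCleanRun K ε ρ X (29 / 20) N r θ} := by
    refine ⟨⌊(29 / 20 : ℝ) * K ^ 9 / (7 * (183 / 100)) + 1⌋₊, fun N hN => ?_⟩
    obtain ⟨r, θ, h⟩ := hN
    exact Nat.le_floor (clean_run_length_le hX h0 hC hK hε hεK hρ hlat (by norm_num)
      (by norm_num) h)
  obtain ⟨hN₀pos, -, hwin⟩ := clean_window_ceil_sharp hK
  set N₀ : ℕ := ⌈76 / 1000 * K ^ 9⌉₊ with hN₀_def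
  have hN₀le : 76 / 1000 * K ^ 9 ≤ (N₀ : ℝ) := Nat.le_ceil _
  have hK9big : (68719476736 : ℝ) ≤ K ^ 9 := by
    have := pow_le_pow_left₀ (by norm_num : (0 : ℝ) ≤ 16) hK 9; norm_num at this; exact this
  obtain ⟨-, -, hk1, -, -, -, -⟩ := unit_lattice_numerics hK hlat
  obtain ⟨r, θ, hsep, hrun⟩ := knob_clean_run_sharp hX h0 hC hK hε hεK hρ 1 hk1 rfl N₀ hN₀pos
    hwin
  have h242 : 242 / K ^ 9 ≤ (1 : ℝ) := by rw [div_le_one hK9]; linarith only [hK9big]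
  have hmem : N₀ ∈ {N : ℕ | ∃ r θ : ℕ → ℝ, IsCleanRun K ε ρ X (29 / 20) N r θ} := by
    refine ⟨r, θ, ?_, fun n hn => ?_, fun n hn => ?_⟩
    · obtain ⟨h, -⟩ := hrun 0 hN₀pos
      push_cast at h; linarith only [h]
    · linarith only [hsep n, h242]
    · obtain ⟨-, hb, hθ1, hθ2, hc, -, hP, -, -, -⟩ := hrun n hn
      exact ⟨⟨hθ1, hθ2⟩, hb, hc, hP⟩
  have hle := le_csSup hbdd hmem
  calc 76 / 1000 * K ^ 9 ≤ (N₀ : ℝ) := hN₀le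
    _ ≤ (cleanHorizon K ε ρ X (29 / 20) : ℝ) := by exact_mod_cast hle

/-! ## §333 The clean dud horizon of the headline member, θ-priced, hypothesis-minimal -/

/-- §333 **THE CLEAN DUD HORIZON OF THE HEADLINE MEMBER, θ-PRICED** (hypothesis-minimal). Let
`K ≥ 16`, `0 < ρ`, `ρ⁴ ≤ 1/(6K⁴⁰)`, and let `X` solve (5.5) for the headline member
`rotorCircuit K K¹⁰ (K¹⁰ρ²) ρ` from `delayInit` (5.6). Then
`0.076K⁹ ≤ cleanHorizon K (K¹⁰ρ²) ρ X (29/20) ≤ 0.1132K⁹ + 1` — part 119 §316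
`knob_clean_horizon_order` with the floor raised from `0.065K⁹` (the two constants a factor
`1.49` apart, for `1.74`). Trigger primitive from part 14, lattice conditions from part 119
§315. HONEST FRAMING: low prior, high value-of-information experiment on Tao's machine
paradigm; NOT a claim that NS blows up.
[derived: this file §332, part 119 §315–§316, part 14 `exists_catalyst_primitive`] -/
theorem knob_clean_horizon_headline_sharp (hK : 16 ≤ K) (hρ : 0 < ρ)
    (hρK : ρ ^ 4 ≤ 1 / (6 * K ^ 40))
    (hX : ∀ t, HasDerivAt X (RotorKnob.rotorCircuit K (K ^ 10) (K ^ 10 * ρ ^ 2) ρ (X t)) t)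
    (h0 : X 0 = delayInit) :
    76 / 1000 * K ^ 9 ≤ (cleanHorizon K (K ^ 10 * ρ ^ 2) ρ X (29 / 20) : ℝ) ∧
      (cleanHorizon K (K ^ 10 * ρ ^ 2) ρ X (29 / 20) : ℝ) ≤ 1132 / 10000 * K ^ 9 + 1 := by
  obtain ⟨C, hC⟩ := exists_catalyst_primitive hX
  obtain ⟨hε, hεK⟩ := headline_lattice_numerics hK hρ hρK
  exact ⟨knob_clean_horizon_floor_sharp hX h0 hC hK hε hεK hρ rfl,
    (knob_clean_horizon_order hK hρ hρK hX h0).2⟩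

/-! ## §334 The dud horizon in time, θ-priced -/

/-- §334 **THE DUD HORIZON OF TAO'S MACHINE IN TIME, θ-PRICED** (hypothesis-minimal). Let
`K ≥ 16`, `0 < ρ`, `ρ⁴ ≤ 1/(6K⁴⁰)`, and let `X` solve (5.5) for the headline member from
`delayInit` (5.6). Then for every time `t ∈ [0, 0.076K⁹ + 1]` the output-mode amplitude obeys
`0 ≤ ã(t)` and `ã(t)² ≤ 1/50` — the last rung of part 127's clean run at `N₀ = ⌈0.076K⁹⌉` sits at
`r > 1.8282 + N₀` with `P(r) ≤ 1/50`, and `ã` is monotone (part 123 §324 `output_dud_of_run`).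
Part 123 §325's window `[0, 0.065K⁹ + 1]`, lengthened. ONE-SIDED: nothing is claimed after
`0.076K⁹ + 1`. HONEST FRAMING as above; nothing about NS.
[derived: part 127 §331, this file `clean_window_ceil_sharp`, part 123 §324, part 119 §315,
part 14 `exists_catalyst_primitive`] -/
theorem knob_output_dud_time_sharp (hK : 16 ≤ K) (hρ : 0 < ρ)
    (hρK : ρ ^ 4 ≤ 1 / (6 * K ^ 40))
    (hX : ∀ t, HasDerivAt X (RotorKnob.rotorCircuit K (K ^ 10) (K ^ 10 * ρ ^ 2) ρ (X t)) t)
    (h0 : X 0 = delayInit) :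
    ∀ t ∈ Icc (0 : ℝ) (76 / 1000 * K ^ 9 + 1), 0 ≤ X t 4 ∧ X t 4 ^ 2 ≤ 1 / 50 := by
  obtain ⟨C, hC⟩ := exists_catalyst_primitive hX
  obtain ⟨hε, hεK⟩ := headline_lattice_numerics hK hρ hρK
  obtain ⟨hN₀pos, -, hwin⟩ := clean_window_ceil_sharp hK
  set N₀ : ℕ := ⌈76 / 1000 * K ^ 9⌉₊ with hN₀_def
  have hN₀le : 76 / 1000 * K ^ 9 ≤ (N₀ : ℝ) := Nat.le_ceil _
  obtain ⟨-, -, hk1, -, -, -, -⟩ := unit_lattice_numerics hK (rfl : K ^ 10 * ρ ^ 2 = K ^ 10 * ρ ^ 2)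
  obtain ⟨r, θ, -, hrun⟩ := knob_clean_run_sharp hX h0 hC hK hε hεK hρ 1 hk1 rfl N₀ hN₀pos hwin
  obtain ⟨hr, -, -, -, -, -, hP, -, -, -⟩ := hrun (N₀ - 1) (by omega)
  have e : (((N₀ - 1 : ℕ) : ℝ)) = (N₀ : ℝ) - 1 := by
    rw [Nat.cast_sub hN₀pos, Nat.cast_one]
  rw [e] at hr
  exact output_dud_of_run (by linarith) hX h0 (by linarith only [hr, hN₀le]) hP

end Summit.NavierStokesRegularity.FluidComputer.GateBudget

end
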